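import Mathlib
import HarnessLib
import HarnessLib.Audit
import Summits.CriticalPhenomena.Statement
import Literature.Barriers.CriticalPhenomena.PositionSpaceRGNonGibbsian
import Literature.Probability.LatticeModels.IsingFieldModel

/-!
Route: SignedFieldRestoration

CLOSED (retired) 2026-08-15T13:48:10Z by operator:999:1257524 — reason: not-a-thesis: assembly does not conclude the sub-problem Statement — note: D-0027 §2.1 audit (human 2026-08-15: routes that do not decide the summit are removed): the assembly concludes `CriticalDecimationGibbs`, not the sub-problem statement; a NEW conforming route may be opened from the same idea (generated `closes : … → _root_.Ising3DConformalLimit`).. The file is kept as the record of this route; refuted decls are indexed as negative knowledge (`ledger negatives`).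

# Route SignedFieldRestoration — Gibbs restoration at the hidden Curie point — Ding–Song–Sun
signed-field domination makes every decimation of the critical 3D Ising measure Gibbsian (barrier
route: β_c H_nn ∈ dom R_T, all b)

BARRIER ROUTE (positive technique-class theorem / barrier surgery, D-0021), realising card
signed-field-gibbs-restoration. Declared up
front: X does NOT imply Summit.CriticalPhenomena.Ising3DConformalLimit nor its negation — X is the
positive complement, AT THE CRITICAL
POINT, of the catalogued barrier `PositionSpaceRGNonGibbsian` (VEFS 1993 Thm 4.2: for β > β_c(2) no
Ising Gibbs measure on ℤ³ has a
quasilocal b = 2 decimation), and the Assembly item concludes in X (precedents: HalfHolomorphic of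
this sub-problem; TaylorResolutionBarrier
of AnomalousDissipation). It suffices to show X = CriticalDecimationGibbs: for every spacing b ≥ 2
and every infinite-volume Gibbs measure μ
of the nearest-neighbour Ising model on ℤ³ at (β_c(3), h = 0), the decimated measure μ∘T_b⁻¹ is
consistent with a quasilocal (= Feller)
specification. Consequently (support CriticalOrbitHamiltonians) `RenormalizedHamiltonianExists 3
(decimate 3 b) (criticalBeta 3) 0` for
all b ≥ 2: the whole Wilson decimation orbit of the critical 3D Hamiltonian lies in dom R_T, the
exact complement of
`PositionSpaceRGNonGibbsian.dim_three`. Mechanism: for a FIELD-TYPE kernel (decimation) the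
constrained system at image configuration ω
is the n.n. ferromagnet on the hidden graph in the SIGNED field induced by the pins; Ding–Song–Sun's
inequality says boundary influence is
maximal at zero field, so the worst image configuration is the neutral one and "no hidden phase
transition, uniformly in ω" collapses to
ONE zero-field statement — vanishing of the ± boundary gap, i.e. m*(β_c(3)) = 0, PROVED in tree
(spontaneousMagnetization_criticalBeta_eq_zero_holds).
Lean: `∀ b : ℕ, 2 ≤ b → ∀ μ ∈ Literature.Probability.LatticeModels.isingGibbsMeasures 3
(Literature.Probability.LatticeModels.criticalBeta 3) 0,
Literature.Barriers.CriticalPhenomena.NonGibbs.IsQuasilocalMeasure (μ.map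
(Literature.Barriers.CriticalPhenomena.NonGibbs.decimate 3 b))`

## Assembly
Pure logic (theorem assembly_holds in the planner's Sketch.lean, sorry-free): SqueezeToQuasilocal at
(d, b, β, h) = (3, b, β_c(3), 0)
(0 ≤ β_c from criticalBeta_nonneg, 1 ≤ b from 2 ≤ b) applied to CriticalScreening b is
CriticalDecimationGibbs. SignedFieldDomination is
carried as the FIRST antecedent although the term proof does not use it: it is the engine from which
CriticalScreening (and
PlanarSharpThreshold, NoMagnetisationRestoration) are to be proved, the one unproved published fact
of the import cone (filed first,
D-0019), and the route's kill switch. NOT an implication to the conjunct (barrier route, see §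
Thesis): X re-opens, for field-type kernels
at criticality, the Hamiltonian-space RG road that the catalogue closes at low temperature, and
gives the RG cards of this sub-problem
(monotone-rg, scaling-flow-omega-limit, zoom-flow-lyapunov-existence, certified-tnrg) an honest
object — the critical decimation orbit —
on which fixed-point / contraction statements can be typed; it does not contract anything itself.

Rationale: WHY THIS LINE. van Enter–Fernández–Sokal (VanenterFernandezSokal1993 §4, Fernández
doi:10.1016/s0924-8099(06)80052-1 §5) reduce non-Gibbsianness of
an RG image to (I) a special image configuration whose constrained system has several phases plus
(II) their selection from afar; every
POSITIVE result to date certifies absence of (I) configuration by configuration with a smallness or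
a rate — Dobrushin–Shlosman
finite-size conditions (HallerKennedy1996, Kennedy2010), strong mixing / complete analyticity of the
constrained models (Martinelli–Olivieri
doi:10.1007/bf01048184, doi:10.1007/bf02179382; Bertini–Cirillo–Olivieri
doi:10.1023/a:1004620929047, doi:10.1007/s00220-005-1399-1;
at criticality only NUMERICALLY, Cirillo–Olivieri doi:10.1007/bf02183617), or a small parameter
(Kennedy arXiv:2006.11429) — none of which
survives at β_c(ℤ³). The import is a 2022 correlation inequality from the random-field-Ising /
mixing literature (DingSongSun2022 =
arXiv:2107.09243 Thm 1.1, used there for RFIM decay and strong spatial mixing, never for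
renormalised measures): pointed at the constrained
system it makes step (I) configuration-UNIFORM for free, because signed fields of either sign can
only screen, and the hypothesis becomes
zero-field uniqueness of the hidden lattice — at β_c(ℤ³) the proved continuity of the magnetisation
(AizenmanDuminilCopinSidoraviciusCMP2015,
a theorem of the tree). The rest is Gibbs formalism already half-built in the barrier's companion
files (the transfer lemmas and
`not_isQuasilocalMeasure_of_gap` of PositionSpaceRGNonGibbsianSpacing.lean are the negative mirror
of SqueezeToQuasilocal). No prior route of
the sub-problem touches the barrier (all 34 Theses "evade" it); the negatives index (one SAW item)
is not involved.

RANKED CRUXES. #0 CriticalDecimationGibbs (target) — for every b ≥ 2 and every μ ∈ 𝒢(β_c(3), 0) on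
ℤ³, the decimation μ∘T_b⁻¹ is a quasilocal measure (consistent with some Feller specification). Card
(T1) at d = 3, β = β_c. (why it might fail: Only through the cruxes (a mis-transcribed DSS, a gap in
the specification construction): decimation's bad configuration needs order on the hidden lattice
ℤ³∖bℤ³ at β_c(ℤ³), excluded by GKS (m*_hidden ≤ m*(β_c) = 0); VEFS §6.1.1 record no evidence of
pathologies at T_c below d_u.) [VanenterFernandezSokal1993, DingSongSun2022,
AizenmanDuminilCopinSidoraviciusCMP2015, HallerKennedy1996, doi:10.1016/s0924-8099(06)80052-1]
#2 SignedFieldDomination (crux) — Ding–Song–Sun 2022, Theorem 1.1, in the tree's finite-volume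
vocabulary (card N1): for a locally finite graph G, a finite volume Λ, β ≥ 0, ANY boundary condition
bc (free or fixed, common to both terms), any field g : V → ℝ and any f ≥ 0, the influence of the
signed perturbation ±f on ⟨σ_o⟩ is maximal when everything else — g AND the boundary condition — is
switched off: ⟨σ_o⟩^{bc}_{Λ;β,g+f} − ⟨σ_o⟩^{bc}_{Λ;β,g−f} ≤ ⟨σ_o⟩^{free}_{Λ;β,f} −
⟨σ_o⟩^{free}_{Λ;β,−f}. (DSS's ±∞ fields = the tree's fixed boundary spins, absorbed into g; the tree
multiplies fields by β, harmless.) To be landed as a Literature fact (Probability/LatticeModels) and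
PROVED: the printed proof is a four-page elementary induction on (|V|, |{h>0}|) with tanh algebra
and FKG (arXiv:2107.09243 §2), all finite sums. [difficulty: L] (why it might fail: Only as
TRANSCRIBED: DSS Remarks 1.2/1.4 show the nearby monotone forms are FALSE (their App. A), and
keeping bc instead of .free on the right is a different, stronger inequality; a ≤ 7-spin exact
enumeration kills wrong forms (kit j000326 tests the filed one and two variants).) [DingSongSun2022,
arXiv:2107.09243, FriedliVelenik2017]
#3 CriticalScreening (crux) — UNIFORM SCREENING of the constrained critical system (card steps 1–3
in finite volume; the heart): d = 3, β = β_c(3), h = 0, every b ≥ 2. For every ε > 0 and every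
finite set Λ′ of image coordinates there are L₀, R such that for all L ≥ L₀ and all boundary
conditions η, η′ that AGREE ON THE IMAGE SITES bℤ³ ∩ box R (arbitrary elsewhere: far pins, all
hidden spins outside the volume), the zero-field expectation of each free image spin σ_{bx}, x ∈ Λ′,
in the volume W_L(Λ′) = box L ∖ (bℤ³ ∖ bΛ′) differs by at most ε: |⟨σ_{bx}⟩^{η}_{W_L;β_c,0} −
⟨σ_{bx}⟩^{η′}_{W_L;β_c,0}| ≤ ε. Intended proof: sandwich η, η′ between η∧η′ ≤ η∨η′ (FKG,
fieldExpect_fixed_mono); SignedFieldDomination with bc := fixed (η∨η′) and f := number of differing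
boundary neighbours ⇒ gap ≤ ± gap of the ZERO-FIELD model on the graph with the agreed pins DELETED
(free comparison); FKG/GKS-II monotonicity (pins ≤ deleted sites re-inserted, subgraph ≤ ℤ³,
isingCorr_plus_mono_graph) ⇒ ≤ ⟨σ_{bx}⟩⁺_{box R} − ⟨σ_{bx}⟩⁻_{box R} on ℤ³ → 2 m*(β_c(3)) = 0
(BoundaryGapVanishes). [deps: SignedFieldDomination] [difficulty: M] (why it might fail: Far pins
stay UNKNOWN (∃L₀ R ∀L ≥ L₀): without signed-field domination the neutral configuration is not known
to be worst, and configuration-uniform uniqueness of the constrained system at β_c(ℤ³) is VEFS's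
open step (I); m*(β_c)=0 gives o(1) in R with no rate.) [DingSongSun2022,
VanenterFernandezSokal1993, AizenmanDuminilCopinSidoraviciusCMP2015, FernandezPfister1997,
doi:10.1007/bf02183617]
#4 SqueezeToQuasilocal (crux) — THE POSITIVE TRANSFER PRINCIPLE (card N2; mirror image of
`not_isQuasilocalMeasure_of_gap`): for any d, any spacing b ≥ 1, β ≥ 0, any field h, if the
finite-volume Ising kernels satisfy the uniform screening property of CriticalScreening (all ε, all
finite Λ′, volumes W_L(Λ′), boundary conditions agreeing on the image sites of box R), then for
EVERY μ ∈ 𝒢(β, h) the decimated measure μ∘T_b⁻¹ is quasilocal. Intended proof (Georgii §1.3 / VEFS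
§2.3–2.4 / Fernández–Pfister): γ′_{Λ′} f (ω) := lim_L ⟨f∘T_b⟩^{η(ω)}_{W_L(Λ′)} exists UNIFORMLY in ω
(Cauchy by finite-volume consistency + the hypothesis; multi-site observables from single-site gaps
by the FKG Lipschitz trick f ↦ f + KΣσ), is independent of the hidden part of η(ω), continuous
(uniform limit of local functions), proper and consistent (limits of the Ising kernels, W_{L₁}(Λ′) ⊆
W_L(Δ)), hence a Feller specification; ν = μ∘T_b⁻¹ satisfies its DLR equations by the DLR equations
of μ in W_L and dominated convergence; b = 1 returns the Ising specification itself (unit test).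
[difficulty: L] (why it might fail: IsQuasilocalMeasure wants a FULL Georgii specification (every
finite Λ′, proper, consistent, Feller) with ν in its DLR set: single-site continuity is not enough;
multi-site control must come from single-site gaps via FKG (β ≥ 0); a.e.→everywhere needs finite
energy; never formalised.) [Georgii2011, VanenterFernandezSokal1993, FernandezPfister1997,
doi:10.1016/s0924-8099(06)80052-1, doi:10.1007/s00220-021-03979-2]
#5 PlanarSharpThreshold (crux) — THE SHARP PLANAR THRESHOLD (card T2, converse of VEFS Thm 4.1 =
`VEFS1993_thm41`, proved in tree): for d = 2, b = 2 and 0 ≤ β ≤ ½ arccosh(1+√2) = israelThreshold =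
0.764285…, every μ ∈ 𝒢(β, 0) on ℤ² has a quasilocal decimation μ∘T₂⁻¹; with Thm 4.1 (non-quasilocal
for every β > israelThreshold) this is the first SHARP Gibbs/non-Gibbs threshold of a lattice RG
map, and it equals the Curie point of the hidden lattice: ℤ²∖2ℤ² is the bond-decorated square
lattice, tanh β′ = tanh²β (decoration–iteration, Fisher1959), critical iff tanh²β = √2 − 1 iff cosh
2β = 1 + √2. Proof plan: SqueezeToQuasilocal at d = 2 + the planar screening from
SignedFieldDomination in its DILUTED form (the free comparison lands on the hidden graph) +
m*_{ℤ²}(β′) = 0 for β′ ≤ β_c(2) (criticalBeta_two, onsager_yang: continuity at β_c(2)) + the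
cosh-tilting argument for the finitely many re-inserted image sites. [deps: SignedFieldDomination,
SqueezeToQuasilocal] [difficulty: L] (why it might fail: At β = israelThreshold the hidden decorated
lattice is EXACTLY critical: the squeeze closes only if its transition is continuous (Onsager–Yang
via decoration; onsager_yang is an unproved named fact); on (β_c(2), israelThreshold] the
full-lattice comparison fails (m* > 0), only the diluted one works.) [VanenterFernandezSokal1993,
HallerKennedy1996, Fisher1959, Onsager1944, Yang1952, DingSongSun2022]
#9 NoMagnetisationRestoration (support) — the general theorem behind the target (card T1,
full-lattice instance): for every d ≥ 1, b ≥ 2 and β ≥ 0 with m*(β) = 0 (no spontaneous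
magnetisation: all β < β_c(d), and β = β_c(d) for d ≥ 3 by the proved continuity, d = 2 by
Onsager–Yang), every μ ∈ 𝒢(β, 0) has quasilocal decimations μ∘T_b⁻¹. Same proof as
SqueezeToQuasilocal + CriticalScreening with β_c(3) replaced by β (the ± box gap → 2m*(β) = 0 by
hasBoxLimit_isingCorr_plus_holds and spin flip). The target is its d = 3 instance
(criticalDecimationGibbs_of_noMag in the planner's Sketch.lean). [difficulty: L] [DingSongSun2022,
VanenterFernandezSokal1993, FriedliVelenik2017]
#9 CriticalOrbitHamiltonians (support) — the barrier-catalogue-facing corollary: for every b ≥ 2 the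
critical nearest-neighbour interaction on ℤ³ lies in dom R_{T_b} — `RenormalizedHamiltonianExists 3
(decimate 3 b) (criticalBeta 3) 0` — the exact complement of `PositionSpaceRGNonGibbsian.dim_three`
(¬ for b = 2, β > β_c(2)); since T_b^k = T_{b^k} (decimate_decimate) the whole Wilson decimation
ORBIT of β_c H_nn exists as renormalised measures with quasilocal specifications. From the target
and the existence of the critical Gibbs measure (hasUniqueGibbsMeasure_criticalBeta_holds); term
proof criticalOrbitHamiltonians_of in Sketch.lean. [difficulty: provable-now]
[VanenterFernandezSokal1993, Kennedy2010, AizenmanDuminilCopinSidoraviciusCMP2015]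
#9 BoundaryGapVanishes (support) — the single zero-field input of CriticalScreening: the ±
boundary-condition gap of the spin at the origin in the box Λ_L at (β_c(3), 0) tends to 0 as L → ∞
(= 2 m*(β_c(3)) = 0: hasBoxLimit_isingCorr_plus_holds, isingExpect_minus_spinAt_eq_neg,
spontaneousMagnetization_criticalBeta_eq_zero_holds; cf. tendsto_isingExpect_plus_spinAt in
CriticalGibbsUniqueness.lean). [difficulty: provable-now] [AizenmanDuminilCopinSidoraviciusCMP2015,
FriedliVelenik2017]

TWO-LAYER PLAN. CriticalScreening ⇐ DominationToDilutedGap (DSS + FKG sandwich: constrained gap ≤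
zero-field ± gap on the pin-deleted graph in box R) →
DilutedGapToFullGap (GKS-II subgraph comparison + BoundaryGapVanishes) → CriticalScreening (k = 2).
SqueezeToQuasilocal ⇐ UniformKernelLimit
(existence, uniformity and continuity of γ′_{Λ′} as a Feller specification) → DLRTransfer (ν ∈ 𝒢(γ′)
from μ's DLR equations) →
SqueezeToQuasilocal (k = 2). PlanarSharpThreshold ⇐ DecoratedCuriePoint (m* of ℤ²∖2ℤ² ∪ finite set
vanishes iff β ≤ israelThreshold, from
criticalBeta_two + onsager_yang + decoration–iteration) → PlanarScreening → PlanarSharpThreshold (k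
= 2). Nothing filed now (D-0019).

KILL CRITERIA. SignedFieldDomination refuted AS FILED (an exact small-graph counterexample to the
tree form) ⇒ one repair by --restate to the literal
DSS form (fields in [−∞, ∞] rendered as pins), else close `refuted:SignedFieldDomination` — every
other item dies with it. CriticalScreening
refuted (a family of image configurations with constrained single-site gaps at β_c(3) bounded below
in every volume) contradicts DSS +
m*(β_c) = 0, so it can only come from a transcription slip: restate once, else close
`refuted:CriticalScreening` and record "signed fields do
not screen uniformly" as a barrier caveat. SqueezeToQuasilocal refuted as stated (hypothesis too
weak for a full specification) ⇒ restate
with the all-observable (total-variation) screening hypothesis, which the same DSS argument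
supplies. PlanarSharpThreshold refuted at the
endpoint only ⇒ restate with β < israelThreshold (strict); refuted inside (β_c(2), israelThreshold)
⇒ the "threshold = hidden Curie point"
thesis is dead in d = 2 and the route shrinks to the 3D target. The target proved elsewhere
(disagreement percolation, Dobrushin–Shlosman
at β_c) moots the line, not the theorem.

NOT DECOMPOSED YET. The FKG/GKS bookkeeping inside CriticalScreening (boundary fields of a fixed
b.c. as a site field, pins ≤ deleted-and-re-inserted sites,
subgraph monotonicity, off-centre boxes) — layer-2 children or `--supports` lemmas; the
Kozlov–Sullivan upgrade from "quasilocal" to "Gibbs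
for a translation-invariant absolutely summable potential in B¹" with explicit decay (needs RATES:
exponential for β < β_c(ℤ³∖bℤ³) via
sharpness on the periodic hidden graph and AizenmanGrimmett1991's strict inequality β_c(ℤ³) <
β_c(ℤ³∖bℤ³); doi:10.1007/s00220-021-03979-2)
— deliberately NOT an item: the barrier's technique class is stated with quasilocal specifications;
the noisy-copy / Kadanoff-bilayer and
hyperplane-projection variants (card T3, (c)); the b^{kdν} localisation-failure law (card (b),
heuristic); H1/H2 by-products of DSS at
second order (card N5). General d is carried only by the support item NoMagnetisationRestoration.

CHEAPEST FALSIFIER. Exact enumeration of the FILED tree form of SignedFieldDomination on random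
graphs with ≤ 7 spins, random volumes, free/fixed boundary
conditions, random signed g and f ≥ 0, β ∈ {0, 0.2, 0.44, 0.764, 1, 2.5, U(0,3)} — together with two
plausible mis-transcriptions that
SHOULD fail (same b.c. instead of free on the right; monotonicity in λ of the gap at λg, false by
DSS Remark 1.2): kit job j000326
(dss_check.py in the planner folder, 4000 trials; verdict recorded in NOTES.md when it returns — a
single violation of the filed form kills
crux 2 as transcribed). Second cheapest: `lean check` that b = 1 of SqueezeToQuasilocal is the Ising
specification (sanity of the volumes
W_L(Λ′)). Literature lookup already done: no configuration-uniform uniqueness result at β_c(ℤ³)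
exists to make the line `known`
(Cirillo–Olivieri 1997 is numerical, Kennedy 2020 has a small ε, HK96/BCO need Dobrushin–Shlosman or
strong-mixing rates).

NUMBERS. β_c(ℤ²) = ½ log(1+√2) = 0.440687 (criticalBetaTwo; criticalBeta_two named fact);
israelThreshold = ½ arccosh(1+√2) = 0.764285 = 1.7343 β_c(2)
(cosh_two_mul_israelThreshold, proved), and tanh²(0.764285) = 0.414214 = √2 − 1 = tanh β_c(2): the
hidden decorated lattice ℤ²∖2ℤ² is
critical exactly at VEFS's Theorem 4.1 constant. β_c(ℤ³) = 0.2216546(1) (Monte Carlo, not used; the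
tree's criticalBeta 3 is abstract) with
m*(β_c(3)) = 0 PROVED (spontaneousMagnetization_criticalBeta_eq_zero_holds) and |𝒢(β_c,0)| = 1
PROVED (hasUniqueGibbsMeasure_criticalBeta_holds);
β_c(ℤ³∖bℤ³) > β_c(ℤ³) strictly (AizenmanGrimmett1991 essential enhancement; the card's estimate
0.2637(10) for b = 2 is unverified here and
not load-bearing). Prior positive ranges: HK96 a neighbourhood of β_c(2) for b = 2 decimation in d =
2 (exact constants cite-only, acq-00531);
VEFS Thms 4.1/4.2 proved in tree (VEFS1993_thm41_holds, VEFS1993_thm42_holds). Items at open: 9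
(target, assembly, 4 cruxes, 3 support).

DEFINITION REQUESTS. None: IsQuasilocalMeasure, Specification.IsFeller, decimate,
RenormalizedHamiltonianExists, israelThreshold (PositionSpaceRGNonGibbsian.lean),
fieldExpect / BoundaryCondition / isingExpect / box / zdGraph / isingGibbsMeasures / criticalBeta /
spontaneousMagnetization all exist. Cite
fact wanted (filed after open as a cite work item): DingSongSun2022 Thm 1.1 as a Literature fact
`Literature/Probability/LatticeModels/
SignedFieldDomination.lean` (statement = crux 2 verbatim), ideally with its elementary proof; Cor.
1.3 (covariance domination
⟨σ_uσ_v⟩_g − ⟨σ_u⟩_g⟨σ_v⟩_g ≤ ⟨σ_uσ_v⟩_0) is wanted by other cards (octave-forgets-more-than-half,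
ball-specification-centre-blindness) but
not by this route.

Novelty: Searches (2026-08-15, this planner; OpenAlex/S2/arXiv HTTP 429, searchd one rc 75): `lit search
--hybrid "decimated Ising model Gibbsian
near critical temperature renormalized measure"` (12 book hits: FriedliVelenik2017 §6.14.2, Cardy,
Lavis–Bell — textbook pathology
discussions only); `lit search "Gibbsianness decimation Ising critical point renormalization group
pathologies" --source all` (local 6:
hep-th/9211048, arXiv:1108.3308, hep-lat/9409016, arXiv:0911.0117, arXiv:2105.07950,
arXiv:1303.2380; crossref 20: Martinelli–Olivieri
1993/1995); `lit search --source zbmath "Martinelli Olivieri pathologies …"` (2); crossref look-ups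
for Bertini–Cirillo–Olivieri (found
doi:10.1023/a:1004620929047, doi:10.1007/s00220-005-1399-1 and Cirillo–Olivieri
doi:10.1007/bf02183617 "RG at criticality … a numerical
study"), Fernández 2006 (doi:10.1016/s0924-8099(06)80052-1), BGMMT 2021
(doi:10.1007/s00220-021-03979-2); `lit galaxy search "decimation
transformation" --star all --title-contains Gibbs` (15, none relevant), `"non-Gibbsian" --star pdf
--title-contains critical` (25: van Enter
reviews, Külske, Lőrinczi–Maes weakly Gibbsian, Jahnel–Külske sharp Kac thresholds, van Enter–Le Ny
Dyson decimation), `"decimated measure is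
Gibbsian" --star all` (0); `lit read arxiv:2107.09243` (Thm 1.1 + proof pp. 6–9 read), `lit read
arxiv:2105.07950` pp. 2–3 (Remark 2a:
positive results via absence of transitions — HK96, Kennedy 2020, BCO06, Berghout–Verbitskiy 1D),
`lit read arxiv:2006.11429` pp. 1–3;  [refs: 10.1023/a:1004620929047, 10.1007/s00220-005-1399-1, 10.1007/bf02183617, 10.1016/s0924-8099(06, 10.1007/s00220-021-03979-2, 10.1007/bf01048184, 1108.3308, 0911.0117, 2105.07950, 1303.2380, 2107.09243, 2006.11429, doi:10.1023/a, doi:10.1007/s00220-005-1399-1, doi:10.1007/bf02183617, doi:10.1016/s0924-8099, doi:10.1007/s00220-021-03979-2, arxiv:2107.09243, arxiv:2105.07950, arxiv:2006.11429, doi:10.1]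

Barriers (technique_class: signed-field-domination, gibbs-restoration): - technique_class: signed-field-domination, gibbs-restoration
- Literature.Barriers.CriticalPhenomena.PositionSpaceRGNonGibbsian: CONFRONTED, not evaded — the
route proves the positive complement of the barrier's technique-class statement at the critical
point (`RenormalizedHamiltonianExists 3 (decimate 3 b) (criticalBeta 3) 0` for all b ≥ 2, vs the
barrier's ¬ for β > β_c(2)); the established statement (VEFS Thm 4.2, proved in tree) is untouched
and complementary, and scope caveat (a) of the catalogue entry ("prove nothing at the critical
point") becomes a theorem line; the Griffiths–Pearce–Israel mechanism is met head-on: its step (I)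
needs order on the hidden lattice, which GKS + m*(β_c(3)) = 0 forbid and DSS makes
configuration-uniform.
- Literature.Barriers.CriticalPhenomena.RigorousRGSmallParameter: it does not evade it; the bet is
only that an EXISTING renormalised-Hamiltonian orbit at criticality is the prerequisite object for
any future non-perturbative contraction argument — no contraction, fixed point or exponent is
claimed here.
- Literature.Barriers.CriticalPhenomena.ScaleCovarianceNotMoebius: not engaged (no covariance claim;
everything is lattice-side Gibbs formalism).
- Literature.Barriers.CriticalPhenomena.IsingTrivialityFromDimensionFour: not engaged (d = 3 fixed;
no U₄ statement).
- Literature.Barriers.CriticalPhenomena.LongRangeTrivialityOnZ3: not engaged (nearest-neighbour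
model only; no Gaussianity claim).
- Negatives index: one refuted statement on this

History (route lifecycle, newest last):
- 2026-08-15T13:48:10Z · CLOSED retired — not-a-thesis: assembly does not conclude the sub-problem Statement (operator:999:1257524)

sub-problem: Ising3DConformalLimit · status: closed(retired) · opened planner-plancard-CriticalPhenomena-Ising3DCon-bc5514cd-0 2026-08-15T12:36:25Z · rev 0 · ledger route-CriticalPhenomena-SignedFieldRestoration
GENERATED by the gate from the ledger (D-0016/17). Provers cite these decls: `theorem foo : Summit.CriticalPhenomena.Ising3DConformalLimit.Theses.SignedFieldRestoration.<Decl> := …` in Summits/CriticalPhenomena/Ising3DConformalLimit/Theorems/<Name>.lean.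
-/

namespace Summit.CriticalPhenomena.Ising3DConformalLimit.Theses.SignedFieldRestoration

open scoped BigOperators Topology Manifold Classical MeasureTheory ProbabilityTheory Matrix InnerProductSpace ComplexConjugate ContinuousMap
open Filter Set Function TopologicalSpace MeasureTheory

attribute [summit_statement] _root_.Ising3DConformalLimit

/-- item stmt-CriticalPhenomena-8275 · target · rank 0 · closed · moot by None · by planner
why it might fail: Only through the cruxes (a mis-transcribed DSS, a gap in the specification construction): decimation's bad configuration needs order on the hidden lattice ℤ³∖bℤ³ at β_c(ℤ³), excluded by GKS (m*_hidden ≤ m*(β_c) = 0); VEFS §6.1.1 record no evidence of pathologies at T_c below d_u.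
sources: VanenterFernandezSokal1993, DingSongSun2022, AizenmanDuminilCopinSidoraviciusCMP2015, HallerKennedy1996, doi:10.1016/s0924-8099(06)80052-1
[target] for every b ≥ 2 and every μ ∈ 𝒢(β_c(3), 0) on ℤ³, the decimation μ∘T_b⁻¹ is a quasilocal
measure (consistent with some Feller specification). Card (T1) at d = 3, β = β_c. -/
@[route_item "route-CriticalPhenomena-SignedFieldRestoration"]
def CriticalDecimationGibbs : Prop :=
  ∀ b : ℕ, 2 ≤ b → ∀ μ ∈ Literature.Probability.LatticeModels.isingGibbsMeasures 3 (Literature.Probability.LatticeModels.criticalBeta 3) 0, Literature.Barriers.CriticalPhenomena.NonGibbs.IsQuasilocalMeasure (μ.map (Literature.Barriers.CriticalPhenomena.NonGibbs.decimate 3 b))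

/-- item stmt-CriticalPhenomena-8276 · crux · rank 2 · closed · moot by None · by planner
why it might fail: Only as TRANSCRIBED: DSS Remarks 1.2/1.4 show the nearby monotone forms are FALSE (their App. A), and keeping bc instead of .free on the right is a different, stronger inequality; a ≤ 7-spin exact enumeration kills wrong forms (kit j000326 tests the filed one and two variants).
sources: DingSongSun2022, arXiv:2107.09243, FriedliVelenik2017
[crux] Ding–Song–Sun 2022, Theorem 1.1, in the tree's finite-volume vocabulary (card N1): for a
locally finite graph G, a finite volume Λ, β ≥ 0, ANY boundary condition bc (free or fixed, common
to both terms), any field g : V → ℝ and any f ≥ 0, the influence of the signed perturbation ±f on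
⟨σ_o⟩ is maximal when everything else — g AND the boundary condition — is switched off:
⟨σ_o⟩^{bc}_{Λ;β,g+f} − ⟨σ_o⟩^{bc}_{Λ;β,g−f} ≤ ⟨σ_o⟩^{free}_{Λ;β,f} − ⟨σ_o⟩^{free}_{Λ;β,−f}. (DSS's
±∞ fields = the tree's fixed boundary spins, absorbed into g; the tree multiplies fields by β,
harmless.) To be landed as a Literature fact (Probability/LatticeModels) and PROVED: the printed
proof is a four-page elementary induction on (|V|, |{h>0}|) with tanh algebra and FKG
(arXiv:2107.09243 §2), all finite sums. [difficulty: L] -/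
@[route_item "route-CriticalPhenomena-SignedFieldRestoration"]
def SignedFieldDomination : Prop :=
  ∀ (V : Type) (G : SimpleGraph V) [DecidableEq V] [G.LocallyFinite] (Λ : Finset V) (β : ℝ), 0 ≤ β → ∀ (g f : V → ℝ), (∀ v, 0 ≤ f v) → ∀ (bc : Literature.Probability.LatticeModels.BoundaryCondition V) (o : V), Literature.Probability.LatticeModels.fieldExpect G Λ β (g + f) bc (Literature.Probability.LatticeModels.spinAt o) - Literature.Probability.LatticeModels.fieldExpect G Λ β (g - f) bc (Literature.Probability.LatticeModels.spinAt o) ≤ Literature.Probability.LatticeModels.fieldExpect G Λ β f .free (Literature.Probability.LatticeModels.spinAt o) - Literature.Probability.LatticeModels.fieldExpect G Λ β (-f) .free (Literature.Probability.LatticeModels.spinAt o)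

/-- item stmt-CriticalPhenomena-8277 · crux · rank 3 · closed · moot by None · by planner
why it might fail: Far pins stay UNKNOWN (∃L₀ R ∀L ≥ L₀): without signed-field domination the neutral configuration is not known to be worst, and configuration-uniform uniqueness of the constrained system at β_c(ℤ³) is VEFS's open step (I); m*(β_c)=0 gives o(1) in R with no rate.
sources: DingSongSun2022, VanenterFernandezSokal1993, AizenmanDuminilCopinSidoraviciusCMP2015, FernandezPfister1997, doi:10.1007/bf02183617
[crux] UNIFORM SCREENING of the constrained critical system (card steps 1–3 in finite volume; the
heart): d = 3, β = β_c(3), h = 0, every b ≥ 2. For every ε > 0 and every finite set Λ′ of image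
coordinates there are L₀, R such that for all L ≥ L₀ and all boundary conditions η, η′ that AGREE ON
THE IMAGE SITES bℤ³ ∩ box R (arbitrary elsewhere: far pins, all hidden spins outside the volume),
the zero-field expectation of each free image spin σ_{bx}, x ∈ Λ′, in the volume W_L(Λ′) = box L ∖
(bℤ³ ∖ bΛ′) differs by at most ε: |⟨σ_{bx}⟩^{η}_{W_L;β_c,0} − ⟨σ_{bx}⟩^{η′}_{W_L;β_c,0}| ≤ ε.
Intended proof: sandwich η, η′ between η∧η′ ≤ η∨η′ (FKG, fieldExpect_fixed_mono);
SignedFieldDomination with bc := fixed (η∨η′) and f := number of differing boundary neighbours ⇒ gap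
≤ ± gap of the ZERO-FIELD model on the graph with the agreed pins DELETED (free comparison);
FKG/GKS-II monotonicity (pins ≤ deleted sites re-inserted, subgraph ≤ ℤ³, isingCorr_plus_mono_graph)
⇒ ≤ ⟨σ_{bx}⟩⁺_{box R} − ⟨σ_{bx}⟩⁻_{box R} on ℤ³ → 2 m*(β_c(3)) = 0 (BoundaryGapVanishes). [deps:
SignedFieldDomination] [difficulty: M] -/
@[route_item "route-CriticalPhenomena-SignedFieldRestoration"]
def CriticalScreening : Prop :=
  ∀ b : ℕ, 2 ≤ b → ∀ ε : ℝ, 0 < ε → ∀ Λ' : Finset (Literature.Probability.LatticeModels.Site 3), ∃ L₀ R : ℕ, ∀ L : ℕ, L₀ ≤ L → ∀ η η' : Literature.Probability.LatticeModels.SpinConfig (Literature.Probability.LatticeModels.Site 3), (∀ y ∈ Literature.Probability.LatticeModels.box 3 R, (∀ i, (b : ℤ) ∣ y i) → η y = η' y) → ∀ x ∈ Λ', |Literature.Probability.LatticeModels.isingExpect (Literature.Probability.LatticeModels.zdGraph 3) ((Literature.Probability.LatticeModels.box 3 L).filter (fun y => (∀ i, (b : ℤ) ∣ y i) → ∃ z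 ∈ Λ', y = fun i => (b : ℤ) * z i)) (Literature.Probability.LatticeModels.criticalBeta 3) 0 (.fixed η) (Literature.Probability.LatticeModels.spinAt (fun i => (b : ℤ) * x i)) - Literature.Probability.LatticeModels.isingExpect (Literature.Probability.LatticeModels.zdGraph 3) ((Literature.Probability.LatticeModels.box 3 L).filter (fun y => (∀ i, (b : ℤ) ∣ y i) → ∃ z ∈ Λ', y = fun i => (b : ℤ) * z i)) (Literature.Probability.LatticeModels.criticalBeta 3) 0 (.fixed η') (Literature.Probability.LatticeModels.spinAt (fun i => (b : ℤ) * x i))| ≤ ε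

/-- item stmt-CriticalPhenomena-8278 · crux · rank 4 · closed · moot by None · by planner
why it might fail: IsQuasilocalMeasure wants a FULL Georgii specification (every finite Λ′, proper, consistent, Feller) with ν in its DLR set: single-site continuity is not enough; multi-site control must come from single-site gaps via FKG (β ≥ 0); a.e.→everywhere needs finite energy; never formalised.
sources: Georgii2011, VanenterFernandezSokal1993, FernandezPfister1997, doi:10.1016/s0924-8099(06)80052-1, doi:10.1007/s00220-021-03979-2
[crux] THE POSITIVE TRANSFER PRINCIPLE (card N2; mirror image of `not_isQuasilocalMeasure_of_gap`):
for any d, any spacing b ≥ 1, β ≥ 0, any field h, if the finite-volume Ising kernels satisfy the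
uniform screening property of CriticalScreening (all ε, all finite Λ′, volumes W_L(Λ′), boundary
conditions agreeing on the image sites of box R), then for EVERY μ ∈ 𝒢(β, h) the decimated measure
μ∘T_b⁻¹ is quasilocal. Intended proof (Georgii §1.3 / VEFS §2.3–2.4 / Fernández–Pfister): γ′_{Λ′} f
(ω) := lim_L ⟨f∘T_b⟩^{η(ω)}_{W_L(Λ′)} exists UNIFORMLY in ω (Cauchy by finite-volume consistency +
the hypothesis; multi-site observables from single-site gaps by the FKG Lipschitz trick f ↦ f +
KΣσ), is independent of the hidden part of η(ω), continuous (uniform limit of local functions),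
proper and consistent (limits of the Ising kernels, W_{L₁}(Λ′) ⊆ W_L(Δ)), hence a Feller
specification; ν = μ∘T_b⁻¹ satisfies its DLR equations by the DLR equations of μ in W_L and
dominated convergence; b = 1 returns the Ising specification itself (unit test). [difficulty: L] -/
@[route_item "route-CriticalPhenomena-SignedFieldRestoration"]
def SqueezeToQuasilocal : Prop :=
  ∀ (d b : ℕ), 1 ≤ b → ∀ (β h : ℝ), 0 ≤ β → (∀ ε : ℝ, 0 < ε → ∀ Λ' : Finset (Literature.Probability.LatticeModels.Site d), ∃ L₀ R : ℕ, ∀ L : ℕ, L₀ ≤ L → ∀ η η' : Literature.Probability.LatticeModels.SpinConfig (Literature.Probability.LatticeModels.Site d), (∀ y ∈ Literature.Probability.LatticeModels.box d R, (∀ i, (b : ℤ) ∣ y i) → η y = η' y) → ∀ x ∈ Λ', |Literature.Probability.LatticeModels.isingExpect (Literature.Probability.LatticeModels.zdGraph d) ((Literature.Probability.LatticeModels.box d L).filter (fun y => (∀ i, (b : ℤ) ∣ y i) → ∃ z ∈ Λ', y = fun i => (b : ℤ) * z i)) β h (.fixed η) (Literature.Probability.LatticeModels.spinAt (fun i =>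 (b : ℤ) * x i)) - Literature.Probability.LatticeModels.isingExpect (Literature.Probability.LatticeModels.zdGraph d) ((Literature.Probability.LatticeModels.box d L).filter (fun y => (∀ i, (b : ℤ) ∣ y i) → ∃ z ∈ Λ', y = fun i => (b : ℤ) * z i)) β h (.fixed η') (Literature.Probability.LatticeModels.spinAt (fun i => (b : ℤ) * x i))| ≤ ε) → ∀ μ ∈ Literature.Probability.LatticeModels.isingGibbsMeasures d β h, Literature.Barriers.CriticalPhenomena.NonGibbs.IsQuasilocalMeasure (μ.map (Literature.Barriers.CriticalPhenomena.NonGibbs.decimate d b))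

/-- item stmt-CriticalPhenomena-8279 · crux · rank 5 · closed · moot by None · by planner
why it might fail: At β = israelThreshold the hidden decorated lattice is EXACTLY critical: the squeeze closes only if its transition is continuous (Onsager–Yang via decoration; onsager_yang is an unproved named fact); on (β_c(2), israelThreshold] the full-lattice comparison fails (m* > 0), only the diluted one works.
sources: VanenterFernandezSokal1993, HallerKennedy1996, Fisher1959, Onsager1944, Yang1952, DingSongSun2022
[crux] THE SHARP PLANAR THRESHOLD (card T2, converse of VEFS Thm 4.1 = `VEFS1993_thm41`, proved in
tree): for d = 2, b = 2 and 0 ≤ β ≤ ½ arccosh(1+√2) = israelThreshold = 0.764285…, every μ ∈ 𝒢(β, 0)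
on ℤ² has a quasilocal decimation μ∘T₂⁻¹; with Thm 4.1 (non-quasilocal for every β >
israelThreshold) this is the first SHARP Gibbs/non-Gibbs threshold of a lattice RG map, and it
equals the Curie point of the hidden lattice: ℤ²∖2ℤ² is the bond-decorated square lattice, tanh β′ =
tanh²β (decoration–iteration, Fisher1959), critical iff tanh²β = √2 − 1 iff cosh 2β = 1 + √2. Proof
plan: SqueezeToQuasilocal at d = 2 + the planar screening from SignedFieldDomination in its DILUTED
form (the free comparison lands on the hidden graph) + m*_{ℤ²}(β′) = 0 for β′ ≤ β_c(2)
(criticalBeta_two, onsager_yang: continuity at β_c(2)) + the cosh-tilting argument for the finitely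
many re-inserted image sites. [deps: SignedFieldDomination, SqueezeToQuasilocal] [difficulty: L] -/
@[route_item "route-CriticalPhenomena-SignedFieldRestoration"]
def PlanarSharpThreshold : Prop :=
  ∀ β : ℝ, 0 ≤ β → β ≤ Literature.Barriers.CriticalPhenomena.NonGibbs.israelThreshold → ∀ μ ∈ Literature.Probability.LatticeModels.isingGibbsMeasures 2 β 0, Literature.Barriers.CriticalPhenomena.NonGibbs.IsQuasilocalMeasure (μ.map (Literature.Barriers.CriticalPhenomena.NonGibbs.decimate 2 2))

/-- item stmt-CriticalPhenomena-8280 · support · rank 9 · closed · moot by None · by planner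
sources: DingSongSun2022, VanenterFernandezSokal1993, FriedliVelenik2017
[support] the general theorem behind the target (card T1, full-lattice instance): for every d ≥ 1, b
≥ 2 and β ≥ 0 with m*(β) = 0 (no spontaneous magnetisation: all β < β_c(d), and β = β_c(d) for d ≥ 3
by the proved continuity, d = 2 by Onsager–Yang), every μ ∈ 𝒢(β, 0) has quasilocal decimations
μ∘T_b⁻¹. Same proof as SqueezeToQuasilocal + CriticalScreening with β_c(3) replaced by β (the ± box
gap → 2m*(β) = 0 by hasBoxLimit_isingCorr_plus_holds and spin flip). The target is its d = 3
instance (criticalDecimationGibbs_of_noMag in the planner's Sketch.lean). [difficulty: L] -/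
@[route_item "route-CriticalPhenomena-SignedFieldRestoration"]
def NoMagnetisationRestoration : Prop :=
  ∀ (d b : ℕ), 1 ≤ d → 2 ≤ b → ∀ β : ℝ, 0 ≤ β → Literature.Probability.LatticeModels.spontaneousMagnetization d β = 0 → ∀ μ ∈ Literature.Probability.LatticeModels.isingGibbsMeasures d β 0, Literature.Barriers.CriticalPhenomena.NonGibbs.IsQuasilocalMeasure (μ.map (Literature.Barriers.CriticalPhenomena.NonGibbs.decimate d b))

/-- item stmt-CriticalPhenomena-8281 · support · rank 9 · closed · moot by None · by planner
sources: VanenterFernandezSokal1993, Kennedy2010, AizenmanDuminilCopinSidoraviciusCMP2015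
[support] the barrier-catalogue-facing corollary: for every b ≥ 2 the critical nearest-neighbour
interaction on ℤ³ lies in dom R_{T_b} — `RenormalizedHamiltonianExists 3 (decimate 3 b)
(criticalBeta 3) 0` — the exact complement of `PositionSpaceRGNonGibbsian.dim_three` (¬ for b = 2, β
> β_c(2)); since T_b^k = T_{b^k} (decimate_decimate) the whole Wilson decimation ORBIT of β_c H_nn
exists as renormalised measures with quasilocal specifications. From the target and the existence of
the critical Gibbs measure (hasUniqueGibbsMeasure_criticalBeta_holds); term proof
criticalOrbitHamiltonians_of in Sketch.lean. [difficulty: provable-now] -/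
@[route_item "route-CriticalPhenomena-SignedFieldRestoration"]
def CriticalOrbitHamiltonians : Prop :=
  ∀ b : ℕ, 2 ≤ b → Literature.Barriers.CriticalPhenomena.NonGibbs.RenormalizedHamiltonianExists 3 (Literature.Barriers.CriticalPhenomena.NonGibbs.decimate 3 b) (Literature.Probability.LatticeModels.criticalBeta 3) 0

/-- item stmt-CriticalPhenomena-8282 · support · rank 9 · closed · moot by None · by planner
sources: AizenmanDuminilCopinSidoraviciusCMP2015, FriedliVelenik2017
[support] the single zero-field input of CriticalScreening: the ± boundary-condition gap of the spin
at the origin in the box Λ_L at (β_c(3), 0) tends to 0 as L → ∞ (= 2 m*(β_c(3)) = 0: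
hasBoxLimit_isingCorr_plus_holds, isingExpect_minus_spinAt_eq_neg,
spontaneousMagnetization_criticalBeta_eq_zero_holds; cf. tendsto_isingExpect_plus_spinAt in
CriticalGibbsUniqueness.lean). [difficulty: provable-now] -/
@[route_item "route-CriticalPhenomena-SignedFieldRestoration"]
def BoundaryGapVanishes : Prop :=
  Filter.Tendsto (fun L : ℕ => Literature.Probability.LatticeModels.isingExpect (Literature.Probability.LatticeModels.zdGraph 3) (Literature.Probability.LatticeModels.box 3 L) (Literature.Probability.LatticeModels.criticalBeta 3) 0 .plus (Literature.Probability.LatticeModels.spinAt 0) - Literature.Probability.LatticeModels.isingExpect (Literature.Probability.LatticeModels.zdGraph 3) (Literature.Probability.LatticeModels.box 3 L) (Literature.Probability.LatticeModels.criticalBeta 3) 0 .minus (Literature.Probability.LatticeModels.spinAt 0)) Filter.atTop (nhds 0)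

/-- item stmt-CriticalPhenomena-8283 · assembly · rank 1 · closed · moot by None · by planner
sources: VanenterFernandezSokal1993, DingSongSun2022
[assembly] SignedFieldDomination → SqueezeToQuasilocal → CriticalScreening → CriticalDecimationGibbs
(the target X; barrier route). -/
@[route_item "route-CriticalPhenomena-SignedFieldRestoration"]
def Assembly : Prop :=
  SignedFieldDomination → SqueezeToQuasilocal → CriticalScreening → CriticalDecimationGibbs

end Summit.CriticalPhenomena.Ising3DConformalLimit.Theses.SignedFieldRestoration
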